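import Mathlib
import HarnessLib
import Literature.Analysis.FluidPDE.SuitableWeak
import Literature.Analysis.FluidPDE.SelfSimilar
import Literature.Analysis.FluidPDE.LocalTypeI
import Literature.Analysis.FluidPDE.NSBoundedMildOseen
import Literature.Analysis.FluidPDE.OseenDuhamelMorreyFarField

/-!
# Stub `stub_radiationBound` (near-field radiation bound) for line decaying-ancient-bridge of
# crux RellichScar.ApexLocalisation

The line's unconditional by-product `NearFieldRadiationBound`: for a field `M` continuous on the
open slab `(-∞, 0) × ℝ³` whose slices obey the scale-invariant Morrey bound
`∫_{B_r(z)} ‖M(τ, y)‖² dy ≤ I r`, the part of the Oseen–Duhamel term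
`∫_{(s,t)} ∫ K(t-τ, x-y)[M(τ,y), M(τ,y)] dy dτ` (`K = oseenKernel`) radiated to a point `x ≠ 0`
from sources at distance `≥ ‖x‖/2` from `x` is already `(1.6)`-sized:
`≤ c₀ I / ‖x‖` with an absolute constant `c₀`, uniformly in `s < t < 0` and in the bound `B` of
`M` (which is not used). This is the specialisation `a = ‖x‖/2` of the general far-field estimate
`Literature.Analysis.FluidPDE.exists_norm_setIntegral_farField_oseenKernel_le_of_integral`
(`Literature/Analysis/FluidPDE/OseenDuhamelMorreyFarField.lean`: dyadic shells, the kernel bound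
`‖K(σ, ζ)[a, b]‖ ≤ C₀ (σ + ‖ζ‖²)^{-2} ‖a‖ ‖b‖` of Koch–Nadirashvili–Seregin–Šverák 2009, (3.8), and
`∫_{(s,t)} ((t-τ) + ρ)^{-2} dτ ≤ ρ^{-1}`), with `c₀ = 2c = 8 C₀`; continuity of the slices
`M(τ, ·)`, `τ < 0`, makes `‖M(τ, ·)‖²` integrable on balls, which is all the general estimate asks.

Sources: G. Koch, N. Nadirashvili, G. Seregin, V. Šverák, Acta Math. 203 (2009), §3 (3.8) and
(1.6); H. Koch, D. Tataru, Adv. Math. 157 (2001), (14); P. G. Lemarié-Rieusset, *The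
Navier–Stokes problem in the 21st century* (2016), ch. 4.
-/

-- the summit and its single sub-problem share the name (CONVENTIONS §1), as in every Theorems file
set_option linter.dupNamespace false

namespace Summit.NavierStokesRegularity.NavierStokesRegularity.Theorems.RellichScarApexLocalisation

open MeasureTheory Set Function Metric Filter Topology TopologicalSpace
open scoped ENNReal NNReal
open Literature.Analysis Literature.Analysis.FluidPDE

local notation "E³" => EuclideanSpace ℝ (Fin 3)

/-- **Near-field radiation bound** (stub `stub_radiationBound` of line decaying-ancient-bridge).
There is an absolute constant `c₀` such that for every field `M` continuous on the open slab
`(-∞, 0) × ℝ³` with the Morrey bound `∫_{B_r(z)} ‖M(τ, y)‖² dy ≤ I r` (`τ < 0`, `r > 0`,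
`I ≥ 0`), all `s < t < 0` and `x ≠ 0`,
`‖∫_{(s,t)} ∫_{‖y-x‖ ≥ ‖x‖/2} K(t-τ, x-y)[M(τ,y), M(τ,y)] dy dτ‖ ≤ c₀ I / ‖x‖`
(the bound `B` on `M` is not needed). Specialisation `a = ‖x‖/2` of
`exists_norm_setIntegral_farField_oseenKernel_le_of_integral`. -/
theorem stub_radiationBound :
    ∃ c₀ : ℝ, ∀ (I B : ℝ) (M : ℝ → E³ → E³), 0 ≤ I →
      ContinuousOn (uncurry M) (Iio (0 : ℝ) ×ˢ univ) →
      (∀ t < 0, ∀ x : E³, ‖M t x‖ ≤ B) →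
      (∀ τ < 0, ∀ (z : E³) (r : ℝ), 0 < r → ∫ y in ball z r, ‖M τ y‖ ^ 2 ≤ I * r) →
      ∀ (s t : ℝ), s < t → t < 0 → ∀ x : E³, x ≠ 0 →
        ‖∫ τ in Ioo s t, ∫ y in {y : E³ | ‖x‖ / 2 ≤ ‖y - x‖},
            oseenKernel (t - τ) (x - y) (M τ y) (M τ y)‖ ≤ c₀ * I / ‖x‖ := by
  obtain ⟨c, _, h⟩ := exists_norm_setIntegral_farField_oseenKernel_le_of_integral
  refine ⟨2 * c, fun I _ M hI hM _ hMor s t _ ht x hx => ?_⟩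
  have hx' : 0 < ‖x‖ := norm_pos_iff.2 hx
  have ha : 0 < ‖x‖ / 2 := by positivity
  -- the slices `M τ`, `τ ∈ (s, t) ⊆ (-∞, 0)`, are continuous, so `‖M τ‖²` is integrable on balls
  have hcont : ∀ τ ∈ Ioo s t, Continuous (M τ) := fun τ hτ =>
    hM.comp_continuous (continuous_const.prodMk continuous_id)
      fun y => mk_mem_prod (mem_Iio.2 (hτ.2.trans ht)) (mem_univ y)
  have hint : ∀ τ ∈ Ioo s t, ∀ r > 0, IntegrableOn (fun y => ‖M τ y‖ ^ 2) (ball x r) :=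
    fun τ hτ r _ => (((hcont τ hτ).norm.pow 2).continuousOn.integrableOn_compact
      (isCompact_closedBall x r)).mono_set ball_subset_closedBall
  calc ‖∫ τ in Ioo s t, ∫ y in {y : E³ | ‖x‖ / 2 ≤ ‖y - x‖},
        oseenKernel (t - τ) (x - y) (M τ y) (M τ y)‖ ≤ c * I / (‖x‖ / 2) :=
      h hI ha hint fun τ hτ r hr => hMor τ (hτ.2.trans ht) x r hr
    _ = 2 * c * I / ‖x‖ := by rw [div_div_eq_mul_div]; ring

end Summit.NavierStokesRegularity.NavierStokesRegularity.Theorems.RellichScarApexLocalisation
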